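import Literature.NumberTheory.Sieve.LinearEquationsInPrimesProofs
import Mathlib.NumberTheory.Chebyshev
import HarnessLib

/-!
# Linear equations in primes: the twin-prime system in the Green–Tao dictionary (Example 1)

Trunk T-SIEVE (`Literature/NumberTheory/Sieve`). Green–Tao 2010, Example 1, reads the
generalised Hardy–Littlewood conjecture on the system `Ψ(n) = (n, n + 2)` (`d = 1`, `t = 2`;
tree: `twinPrimeSystem`, with `isNondegenerateSystem_twinPrimeSystem` and
`localFactor_twinPrimeSystem_two : β₂ = 2` already in `LinearEquationsInPrimes.lean`). This file
completes the dictionary entries of that example, as consumed by users of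
`GeneralizedHardyLittlewood` at `d = 1`:

* `twinPrimeSystem_eval_zero/one`, `twinPrimeSystem_realEval_zero/one` — `ψ₁(n) = n`,
  `ψ₂(n) = n + 2`;
* `affLinSize_twinPrimeSystem_le` — `‖Ψ‖_N = 2 + 2/N ≤ 3` for `N ≥ 2`;
* `vonMangoldtSum_twinPrimeSystem` — over the full box `K = [-N, N]` the weighted sum (1.2) is
  `∑_{n=1}^{N} Λ(n) Λ(n+2)`;
* `archFactor_twinPrimeSystem` — `β_∞([-N, N]) = vol((0, N]) = N`;
* `goodCount_twinPrimeSystem`, `localFactor_twinPrimeSystem_odd` — for odd `p`,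
  `β_p = p(p-2)/(p-1)² = 1 - 1/(p-1)²`;
* `one_le_singularProductPartial_twinPrimeSystem`, `one_le_singularProduct_twinPrimeSystem` —
  `∏_{p ≤ x} β_p ≥ 2 · ∏_{m=2}^{x}(1 - 1/m²) = (x+1)/x ≥ 1`, hence `𝔖 = ∏_p β_p ≥ 1` (the value
  is `2 Π₂ ≈ 1.32`, not needed here);
* `twinCorrelation_le_of_no_twinPrimes` — the elementary converse direction used in hardness
  certificates: if no `n > n₀` has `n, n + 2` both prime, then
  `∑_{n ≤ N} Λ(n)Λ(n+2) ≤ log(N+2) (ψ(n₀) + (ψ-θ)(N) + (ψ-θ)(N+2))` (`= O(√N log N)` by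
  Chebyshev).

## References

* B. Green, T. Tao, *Linear equations in primes*, Ann. of Math. (2) 171 (2010), 1753–1850,
  Example 1 (twin primes: `β₂ = 2`, `β_p = 1 - 1/(p-1)²`, `β_∞ = N`, the prediction
  `∑_{n ≤ N} Λ(n)Λ(n+2) = 2Π₂ N (1 + o(1))`).
-/

noncomputable section

open Filter Finset MeasureTheory
open scoped Topology ArithmeticFunction.vonMangoldt Chebyshev

namespace Literature.NumberTheory.Sieve

/-! ### Values and size -/

/-- `ψ₁(n) = n` for the twin-prime system. [cite: GreenTao2010, Example 1] -/
theorem twinPrimeSystem_eval_zero (n : Fin 1 → ℤ) : (twinPrimeSystem 0).eval n = n 0 := by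
  simp [twinPrimeSystem, AffLinForm.eval]

/-- `ψ₂(n) = n + 2` for the twin-prime system. [cite: GreenTao2010, Example 1] -/
theorem twinPrimeSystem_eval_one (n : Fin 1 → ℤ) : (twinPrimeSystem 1).eval n = n 0 + 2 := by
  simp [twinPrimeSystem, AffLinForm.eval]

/-- `ψ₁(x) = x` on `ℝ` for the twin-prime system. [cite: GreenTao2010, Example 1] -/
theorem twinPrimeSystem_realEval_zero (x : Fin 1 → ℝ) :
    (twinPrimeSystem 0).realEval x = x 0 := by
  simp [twinPrimeSystem, AffLinForm.realEval]

/-- `ψ₂(x) = x + 2` on `ℝ` for the twin-prime system. [cite: GreenTao2010, Example 1] -/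
theorem twinPrimeSystem_realEval_one (x : Fin 1 → ℝ) :
    (twinPrimeSystem 1).realEval x = x 0 + 2 := by
  simp [twinPrimeSystem, AffLinForm.realEval]

/-- `‖Ψ‖_N = |1| + |1| + |0/N| + |2/N| ≤ 3` for the twin-prime system and `N ≥ 2`.
[cite: GreenTao2010, Example 1] -/
theorem affLinSize_twinPrimeSystem_le {N : ℕ} (hN : 2 ≤ N) :
    affLinSize twinPrimeSystem (N : ℝ) ≤ 3 := by
  have hN' : (2 : ℝ) ≤ N := by exact_mod_cast hN
  have hN0 : (0 : ℝ) < N := by linarith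
  unfold affLinSize
  simp only [Fin.sum_univ_two, Fin.sum_univ_one, twinPrimeSystem, Matrix.cons_val_zero,
    Matrix.cons_val_one, Int.cast_one, abs_one, Int.cast_zero, zero_div,
    abs_zero, zero_add, Int.cast_ofNat]
  have h2 : |(2 : ℝ) / N| ≤ 1 := by
    rw [abs_of_nonneg (by positivity), div_le_one hN0]; exact hN'
  linarith

/-! ### The weighted sum and the archimedean factor over the full box -/

/-- Sums over the `d = 1` box `piFinset (fun _ : Fin 1 => s)` are sums over `s` (any index
type; `sum_piFinset_fin_one` is the case `s : Finset ℕ`). [folklore] -/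
theorem sum_piFinset_const_fin_one {α M : Type*} [AddCommMonoid M] (s : Finset α)
    (f : (Fin 1 → α) → M) :
    ∑ n ∈ Fintype.piFinset (fun _ : Fin 1 => s), f n = ∑ m ∈ s, f (fun _ => m) := by
  refine Finset.sum_nbij' (fun n => n 0) (fun m _ => m) (fun n hn => ?_) (fun m hm => ?_)
    (fun n _ => ?_) (fun m _ => rfl) (fun n _ => ?_)
  · exact Fintype.mem_piFinset.mp hn 0
  · exact Fintype.mem_piFinset.mpr fun _ => hm
  · funext i; simp [Fin.fin_one_eq_zero i]
  · congr 1; funext i; simp [Fin.fin_one_eq_zero i]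

/-- The von Mangoldt sum (1.2) of the twin-prime system over the full box `[-N, N]` is
`∑_{n=1}^{N} Λ(n) Λ(n+2)` (the terms with `n ≤ 0` vanish since `Λ` is `0` on `ℤ_{≤ 0}`).
[cite: GreenTao2010, Example 1] -/
theorem vonMangoldtSum_twinPrimeSystem (N : ℕ) :
    vonMangoldtSum twinPrimeSystem (realBox 1 N) N = ∑ n ∈ Icc 1 N, Λ n * Λ (n + 2) := by
  classical
  unfold vonMangoldtSum
  rw [Finset.filter_true_of_mem]
  swap
  · intro n hn
    have hn' := Fintype.mem_piFinset.mp hn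
    simp only [realBox, Set.mem_Icc]
    refine ⟨fun j => ?_, fun j => ?_⟩
    · have := (Finset.mem_Icc.mp (hn' j)).1
      simp only [realPoint]; exact_mod_cast this
    · have := (Finset.mem_Icc.mp (hn' j)).2
      simp only [realPoint]; exact_mod_cast this
  unfold latticeBox
  rw [sum_piFinset_const_fin_one]
  simp only [Fin.prod_univ_two, twinPrimeSystem_eval_zero, twinPrimeSystem_eval_one,
    intVonMangoldt]
  -- drop the terms `m ≤ 0`
  have hsub : Icc (1 : ℤ) N ⊆ Icc (-(N : ℤ)) N := Icc_subset_Icc (by omega) le_rfl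
  rw [← Finset.sum_subset hsub]
  swap
  · intro m hm hm'
    simp only [Finset.mem_Icc, not_and, not_le] at hm hm'
    have hm0 : m ≤ 0 := by
      by_contra h
      exact absurd (hm' (by omega)) (by omega)
    rw [Int.toNat_eq_zero.mpr hm0, ArithmeticFunction.map_zero, zero_mul]
  -- reindex `m = n`
  refine Finset.sum_nbij' (fun m => m.toNat) (fun n => (n : ℤ)) (fun m hm => ?_) (fun n hn => ?_)
    (fun m hm => ?_) (fun n _ => by simp) (fun m hm => ?_)
  · simp only [Finset.mem_Icc] at hm ⊢; omega
  · simp only [Finset.mem_Icc] at hn ⊢; omega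
  · simp only [Finset.mem_Icc] at hm; omega
  · simp only [Finset.mem_Icc] at hm
    rw [show (m + 2).toNat = m.toNat + 2 by omega]

/-- `β_∞ = vol([-N, N] ∩ {x > 0} ∩ {x + 2 > 0}) = vol((0, N]) = N` for the twin-prime system.
[cite: GreenTao2010, Example 1] -/
theorem archFactor_twinPrimeSystem (N : ℕ) : archFactor twinPrimeSystem (realBox 1 N) = N := by
  unfold archFactor
  have hset : realBox 1 (N : ℝ) ∩ {x | ∀ i, 0 < (twinPrimeSystem i).realEval x} =
      Set.pi Set.univ (fun _ : Fin 1 => Set.Ioc (0 : ℝ) N) := by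
    ext x
    simp only [realBox, Set.mem_inter_iff, Set.mem_Icc, Set.mem_setOf_eq, Set.mem_pi,
      Set.mem_univ, true_implies, Set.mem_Ioc, Fin.forall_fin_two, Fin.forall_fin_one,
      Pi.le_def, twinPrimeSystem_realEval_zero, twinPrimeSystem_realEval_one]
    constructor
    · rintro ⟨⟨-, h2⟩, h3, -⟩
      exact ⟨h3, h2⟩
    · rintro ⟨h1, h2⟩
      have hN : (0 : ℝ) ≤ N := Nat.cast_nonneg N
      exact ⟨⟨by linarith, h2⟩, h1, by linarith⟩
  rw [hset, Real.volume_pi_Ioc_toReal]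
  · simp
  · intro i
    exact Nat.cast_nonneg N

/-! ### Local factors at odd primes and the singular product -/

/-- `ψ₁ ≡ v` modulo `p`. [cite: GreenTao2010, Example 1] -/
theorem twinPrimeSystem_modEval_zero {p : ℕ} (v : Fin 1 → ZMod p) :
    (twinPrimeSystem 0).modEval p v = v 0 := by
  simp [twinPrimeSystem, AffLinForm.modEval]

/-- `ψ₂ ≡ v + 2` modulo `p`. [cite: GreenTao2010, Example 1] -/
theorem twinPrimeSystem_modEval_one {p : ℕ} (v : Fin 1 → ZMod p) :
    (twinPrimeSystem 1).modEval p v = v 0 + 2 := by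
  simp [twinPrimeSystem, AffLinForm.modEval]

/-- For an odd prime `p`, exactly `p - 2` residues `v (mod p)` have `v ≢ 0` and `v + 2 ≢ 0`
("`ℙ(n, n+2 ≢ 0) = 1 - 2/p`"). [cite: GreenTao2010, Example 1] -/
theorem goodCount_twinPrimeSystem {p : ℕ} [hp : Fact p.Prime] (hp2 : p ≠ 2) :
    goodCount twinPrimeSystem p = p - 2 := by
  have h20 : (2 : ZMod p) ≠ 0 := by
    intro h
    have h' : ((2 : ℕ) : ZMod p) = 0 := by exact_mod_cast h
    rw [ZMod.natCast_eq_zero_iff] at h'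
    exact hp2 ((Nat.prime_dvd_prime_iff_eq hp.out Nat.prime_two).mp h')
  unfold goodCount
  have hcard : #{v : Fin 1 → ZMod p | ∀ i, ¬ (twinPrimeSystem i).modEval p v = 0} =
      #{w : ZMod p | w ∉ ({0, -2} : Finset (ZMod p))} := by
    refine Finset.card_nbij' (fun v => v 0) (fun w _ => w) (fun v hv => ?_) (fun w hw => ?_)
      (fun v _ => ?_) (fun w _ => rfl)
    · simp only [Finset.coe_filter, Finset.mem_univ, true_and, Set.mem_setOf_eq,
        Fin.forall_fin_two, twinPrimeSystem_modEval_zero, twinPrimeSystem_modEval_one] at hv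
      simp only [Finset.coe_filter, Finset.mem_univ, true_and, Set.mem_setOf_eq,
        Finset.mem_insert, Finset.mem_singleton, not_or]
      exact ⟨hv.1, fun h => hv.2 (by rw [h]; ring)⟩
    · simp only [Finset.coe_filter, Finset.mem_univ, true_and, Set.mem_setOf_eq,
        Finset.mem_insert, Finset.mem_singleton, not_or] at hw
      simp only [Finset.coe_filter, Finset.mem_univ, true_and, Set.mem_setOf_eq,
        Fin.forall_fin_two, twinPrimeSystem_modEval_zero, twinPrimeSystem_modEval_one]
      exact ⟨hw.1, fun h => hw.2 (by linear_combination h)⟩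
    · funext i; simp [Fin.fin_one_eq_zero i]
  rw [hcard, Finset.filter_not, Finset.filter_mem_eq_inter, Finset.univ_inter,
    Finset.card_univ_sdiff, ZMod.card, Finset.card_pair]
  exact fun h => h20 (neg_eq_zero.mp h.symm)

/-- For an odd prime `p`, `β_p = p (p - 2)/(p - 1)² = 1 - 1/(p - 1)²` for the twin-prime system.
[cite: GreenTao2010, Example 1] -/
theorem localFactor_twinPrimeSystem_odd {p : ℕ} (hp : p.Prime) (hp2 : p ≠ 2) :
    localFactor twinPrimeSystem p = 1 - 1 / ((p : ℝ) - 1) ^ 2 := by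
  haveI := Fact.mk hp
  rw [localFactor_prime, goodCount_twinPrimeSystem hp2, pow_one, Nat.cast_sub hp.two_le]
  have hp3 : (3 : ℝ) ≤ p := by
    have := hp.two_le
    exact_mod_cast (show 3 ≤ p by omega)
  have hp1 : (p : ℝ) - 1 ≠ 0 := by linarith
  have hp0 : (p : ℝ) ≠ 0 := by linarith
  field_simp
  push_cast
  ring

/-- Telescoping: `∏_{m=2}^{x} (1 - 1/m²) = (x + 1)/(2x)` for `x ≥ 1` (cf. the `(m²)⁻¹` form
`Literature.NumberTheory.EllipticCurves.ModularForms.prod_Icc_one_sub_inv_sq`). [folklore] -/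
theorem prod_Icc_two_one_sub_one_div_sq {x : ℕ} (hx : 1 ≤ x) :
    ∏ m ∈ Icc 2 x, (1 - 1 / (m : ℝ) ^ 2) = ((x : ℝ) + 1) / (2 * x) := by
  induction x with
  | zero => omega
  | succ k ih =>
    rcases Nat.eq_zero_or_pos k with rfl | hk
    · norm_num
    · rw [Finset.prod_Icc_succ_top (by omega), ih hk]
      have hk0 : (k : ℝ) ≠ 0 := by exact_mod_cast hk.ne'
      have hk1 : (k : ℝ) + 1 ≠ 0 := by positivity
      push_cast
      field_simp
      ring

/-- `∏_{p ≤ x} β_p ≥ 1` for the twin-prime system (`x ≥ 2`): `β₂ = 2` and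
`∏_{2 < p ≤ x} (1 - 1/(p-1)²) ≥ ∏_{m=2}^{x} (1 - 1/m²) = (x+1)/(2x) ≥ 1/2`.
[cite: GreenTao2010, Example 1] -/
theorem one_le_singularProductPartial_twinPrimeSystem {x : ℕ} (hx : 2 ≤ x) :
    1 ≤ singularProductPartial twinPrimeSystem x := by
  unfold singularProductPartial
  have h2mem : 2 ∈ Nat.primesLE x := Nat.mem_primesLE.mpr ⟨hx, Nat.prime_two⟩
  rw [← Finset.mul_prod_erase _ _ h2mem, localFactor_twinPrimeSystem_two]
  set P := (Nat.primesLE x).erase 2 with hP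
  have hPmem : ∀ p ∈ P, p.Prime ∧ p ≠ 2 ∧ p ≤ x := by
    intro p hp
    obtain ⟨hp2, hp'⟩ := Finset.mem_erase.mp hp
    obtain ⟨hpx, hpp⟩ := Nat.mem_primesLE.mp hp'
    exact ⟨hpp, hp2, hpx⟩
  rw [Finset.prod_congr rfl fun p hp =>
    localFactor_twinPrimeSystem_odd (hPmem p hp).1 (hPmem p hp).2.1]
  -- reindex by `p ↦ p - 1`
  have hinj : Set.InjOn (fun p : ℕ => (p - 1 : ℕ)) P := by
    intro p hp q hq h
    have := (hPmem p hp).1.one_le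
    have := (hPmem q hq).1.one_le
    simp only at h
    omega
  have himage : ∏ p ∈ P, (1 - 1 / ((p : ℝ) - 1) ^ 2) =
      ∏ m ∈ P.image (fun p : ℕ => (p - 1 : ℕ)), (1 - 1 / ((m : ℕ) : ℝ) ^ 2) := by
    rw [Finset.prod_image hinj]
    refine Finset.prod_congr rfl fun p hp => ?_
    rw [Nat.cast_sub (hPmem p hp).1.one_le, Nat.cast_one]
  have hsub : P.image (fun p : ℕ => (p - 1 : ℕ)) ⊆ Icc 2 x := by
    intro m hm
    obtain ⟨p, hp, rfl⟩ := Finset.mem_image.mp hm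
    obtain ⟨hpp, hp2, hpx⟩ := hPmem p hp
    have := hpp.two_le
    exact Finset.mem_Icc.mpr ⟨by omega, by omega⟩
  have hle : ∏ m ∈ Icc 2 x, (1 - 1 / ((m : ℕ) : ℝ) ^ 2) ≤
      ∏ m ∈ P.image (fun p : ℕ => (p - 1 : ℕ)), (1 - 1 / ((m : ℕ) : ℝ) ^ 2) := by
    refine Finset.prod_le_prod_of_subset_of_le_one hsub (fun m hm => ?_) (fun m hm _ => ?_)
    · have hm2 : (2 : ℝ) ≤ m := by exact_mod_cast (Finset.mem_Icc.mp hm).1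
      have : 1 / (m : ℝ) ^ 2 ≤ 1 := by
        rw [div_le_one (by positivity)]; nlinarith
      linarith
    · have : 0 ≤ 1 / (m : ℝ) ^ 2 := by positivity
      linarith
  rw [himage]
  rw [prod_Icc_two_one_sub_one_div_sq (by omega)] at hle
  have hx' : (2 : ℝ) ≤ x := by exact_mod_cast hx
  have hhalf : (1 : ℝ) / 2 ≤ ((x : ℝ) + 1) / (2 * x) := by
    rw [div_le_div_iff₀ (by norm_num) (by positivity)]; linarith
  linarith

/-- **`𝔖 = ∏_p β_p ≥ 1`** for the twin-prime system: the ordered partial products converge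
(Lemma 1.3, `tendsto_singularProductPartial_holds`) and are `≥ 1` from `x = 2` on; the actual
value `2 Π₂ = 2 ∏_{p > 2} (1 - 1/(p-1)²) ≈ 1.3203` is not needed. [cite: GreenTao2010, Example 1] -/
theorem one_le_singularProduct_twinPrimeSystem : 1 ≤ singularProduct twinPrimeSystem :=
  ge_of_tendsto (tendsto_singularProductPartial_holds 1 2 twinPrimeSystem
    isNondegenerateSystem_twinPrimeSystem.1)
    (eventually_atTop.2 ⟨2, fun _ hx => one_le_singularProductPartial_twinPrimeSystem hx⟩)

/-! ### The elementary upper bound in the absence of twin primes -/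

/-- If there are no twin primes `(n, n+2)` with `n > n₀`, then for every `N`,
`∑_{n ≤ N} Λ(n)Λ(n+2) ≤ log(N+2) · (ψ(n₀) + (ψ - θ)(N) + (ψ - θ)(N+2))`: a non-zero term has
`n ≤ n₀`, or `n` a non-prime prime power, or `n + 2` a non-prime prime power; each factor is at
most `log(N + 2)`, `∑_{n ≤ M, n not prime} Λ(n) = ψ(M) - θ(M)` (`= O(√M)`, Chebyshev).
[folklore] -/
theorem twinCorrelation_le_of_no_twinPrimes {n₀ : ℕ}
    (hno : ∀ n, n₀ < n → ¬ (n.Prime ∧ (n + 2).Prime)) (N : ℕ) :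
    ∑ n ∈ Icc 1 N, Λ n * Λ (n + 2) ≤
      Real.log (N + 2) *
        ((∑ n ∈ Icc 1 n₀, Λ n) + (ψ N - θ N) + (ψ (N + 2 : ℕ) - θ (N + 2 : ℕ))) := by
  have hlog0 : 0 ≤ Real.log (N + 2) :=
    Real.log_nonneg (by linarith [(Nat.cast_nonneg N : (0 : ℝ) ≤ N)])
  have hIcc : ∀ M : ℕ, Finset.Ioc 0 M = Finset.Icc 1 M := fun M =>
    (Finset.Icc_add_one_left_eq_Ioc 0 M).symm
  -- pointwise bound
  have hpt : ∀ n ∈ Icc 1 N, Λ n * Λ (n + 2) ≤ Real.log (N + 2) *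
      ((if n ≤ n₀ then Λ n else 0) + (if n.Prime then 0 else Λ n) +
        (if (n + 2).Prime then 0 else Λ (n + 2))) := by
    intro n hn
    obtain ⟨hn1, hnN⟩ := Finset.mem_Icc.mp hn
    have hΛn : Λ n ≤ Real.log (N + 2) := by
      refine ArithmeticFunction.vonMangoldt_le_log.trans (Real.log_le_log ?_ ?_)
      · exact_mod_cast hn1
      · have : (n : ℝ) ≤ N := by exact_mod_cast hnN
        linarith
    have hΛn2 : Λ (n + 2) ≤ Real.log (N + 2) := by
      refine ArithmeticFunction.vonMangoldt_le_log.trans (Real.log_le_log ?_ ?_)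
      · positivity
      · push_cast
        have : (n : ℝ) ≤ N := by exact_mod_cast hnN
        linarith
    have h0n : 0 ≤ Λ n := ArithmeticFunction.vonMangoldt_nonneg
    have h0n2 : 0 ≤ Λ (n + 2) := ArithmeticFunction.vonMangoldt_nonneg
    by_cases hle : n ≤ n₀
    · rw [if_pos hle]
      have hb : 0 ≤ (if n.Prime then 0 else Λ n) := by split_ifs <;> simp [h0n]
      have hc : 0 ≤ (if (n + 2).Prime then 0 else Λ (n + 2)) := by split_ifs <;> simp [h0n2]
      nlinarith [mul_le_mul_of_nonneg_left hΛn2 h0n]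
    · rw [if_neg hle]
      have hnt := hno n (not_le.mp hle)
      by_cases hp : n.Prime
      · have hq : ¬ (n + 2).Prime := fun hq => hnt ⟨hp, hq⟩
        rw [if_pos hp, if_neg hq]
        nlinarith [mul_le_mul_of_nonneg_right hΛn h0n2]
      · rw [if_neg hp]
        have hc : 0 ≤ (if (n + 2).Prime then 0 else Λ (n + 2)) := by split_ifs <;> simp [h0n2]
        nlinarith [mul_le_mul_of_nonneg_left hΛn2 h0n]
  refine (Finset.sum_le_sum hpt).trans ?_
  rw [← Finset.mul_sum, Finset.sum_add_distrib, Finset.sum_add_distrib]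
  refine mul_le_mul_of_nonneg_left ?_ hlog0
  refine add_le_add (add_le_add ?_ ?_) ?_
  · -- `n ≤ n₀` part
    rw [← Finset.sum_filter]
    refine Finset.sum_le_sum_of_subset_of_nonneg (fun n hn => ?_)
      (fun n _ _ => ArithmeticFunction.vonMangoldt_nonneg)
    simp only [Finset.mem_filter, Finset.mem_Icc] at hn ⊢
    omega
  · -- non-primes up to `N`
    rw [Chebyshev.psi_sub_theta_eq_sum_not_prime, Nat.floor_natCast, hIcc, Finset.sum_filter]
    refine Finset.sum_le_sum fun n _ => ?_
    split_ifs <;> simp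
  · -- non-primes up to `N + 2`
    rw [Chebyshev.psi_sub_theta_eq_sum_not_prime, Nat.floor_natCast, hIcc, Finset.sum_filter]
    have hmap : ∑ n ∈ Icc 1 N, (if (n + 2).Prime then (0 : ℝ) else Λ (n + 2)) =
        ∑ m ∈ Icc (1 + 2) (N + 2), (if m.Prime then (0 : ℝ) else Λ m) := by
      rw [← Finset.map_add_right_Icc, Finset.sum_map]
      rfl
    rw [hmap]
    calc ∑ m ∈ Icc (1 + 2) (N + 2), (if m.Prime then (0 : ℝ) else Λ m)
        ≤ ∑ m ∈ Icc 1 (N + 2), (if m.Prime then (0 : ℝ) else Λ m) := by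
          refine Finset.sum_le_sum_of_subset_of_nonneg (Icc_subset_Icc (by omega) le_rfl)
            (fun m _ _ => ?_)
          split_ifs
          · exact le_rfl
          · exact ArithmeticFunction.vonMangoldt_nonneg
      _ = ∑ m ∈ Icc 1 (N + 2), (if ¬ m.Prime then Λ m else 0) := by
          refine Finset.sum_congr rfl fun m _ => ?_
          split_ifs <;> simp_all

end Literature.NumberTheory.Sieve
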